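import Summits.Ventures.YMGap.Thresholds.HessianSharp

/-!
# Venture YMGap — Theorem C is sharp: the constant `4d` is attained (Prop. D of HESSIAN-SHARP)

HONEST FRAMING: venture file (cell `pub-ymgap`, track (a), item A2). This file kernel-checks the
ATTAINMENT half of Theorem C (`p2/HESSIAN-SHARP.md` §3 / Prop. D of `paper/gap-below-beta0prime.md`):
on the torus `(ℤ/2)^d`, `d = k + 2 ≥ 2`, with `N = m + 2 ≥ 2` colours, there is an `SU(N)`-valued
configuration `Q` (the `ℤ₂`-frustrated one: every plaquette holonomy is `-1` on an `su(2)` corner)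
and a non-zero family of traceless skew-Hermitian directions `X` (staggered, divergence-free) with

  `hessianForm Q X = 4d · Σ_e ‖X_e‖²`   (`hessianForm_attained`).

So the constant `4d` of `hessianForm_le_four_d` cannot be lowered, already for `SU(N)` links and
`𝔰𝔲(N)` directions on a single torus; with `WilsonHessian.lean` / `SharpWindow.lean` this says
that `1/(8d)` is the exact reach of the pointwise Bakry–Émery argument in Shen–Zhu–Zhu's metric.
No measure or threshold statement is made here.

Witness (HESSIAN-SHARP Prop. D): `Q(x,j) = diag(q,q,1,…,1)`, `q = Π_{k<j} (-1)^{x_k}`;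
`X(x,i) = χ(x) c_i · diag(i,-i,0,…,0)`, `χ(x) = Π_k (-1)^{x_k}`, `c = e₀ - e₁`. Then every plaquette
word has corner holonomy `-1`, `(dX)_p = 2χ(c_i - c_j)`, `plaqHess = 8(c_i-c_j)²`,
`Σ_{i<j}(c_i-c_j)² = 2d`, `Σ_e‖X_e‖² = 4 · 2^d`, `hessianForm = 16d · 2^d`.
-/

noncomputable section

namespace Summit.Ventures.YMGap.HessianSharp

open Matrix Complex Finset
open Literature.MathematicalPhysics.QuantumFieldTheory
open scoped Matrix ComplexConjugate BigOperators

namespace Attained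

/-! ## Parity signs on `(ℤ/2)^d` -/

/-- The sign `(-1)^a` of a residue `a ∈ ℤ/2`. -/
def sgn (a : ZMod 2) : ℝ := if a = 0 then 1 else -1

/-- `(-1)^{a+1} = -(-1)^a`. -/
theorem sgn_add_one (a : ZMod 2) : sgn (a + 1) = -sgn a := by
  unfold sgn
  rcases (by decide : ∀ a : ZMod 2, a = 0 ∨ a = 1) a with h | h <;> rw [h]
  · simp
  · have h1 : (1 : ZMod 2) + 1 = 0 := by decide
    have h2 : ¬ ((1 : ZMod 2) = 0) := by decide
    simp [h1, h2]

/-- `((-1)^a)² = 1`. -/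
theorem sgn_mul_self (a : ZMod 2) : sgn a * sgn a = 1 := by
  unfold sgn; split_ifs <;> norm_num

variable {d : ℕ}

/-- The staggering sign `χ(x) = Π_k (-1)^{x_k}`. -/
def chi (x : Site d 2) : ℝ := ∏ k, sgn (x k)

/-- The frustrating link sign `q(x,j) = Π_{k<j} (-1)^{x_k}`. -/
def qsign (x : Site d 2) (j : Fin d) : ℝ := ∏ k ∈ Finset.univ.filter (fun k => k < j), sgn (x k)

/-- Coordinates of a shifted site: only the `i`-th coordinate moves, by `+1`. -/
theorem sgn_shift_apply (x : Site d 2) (i : Fin d) :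
    (fun k => sgn ((x.shift i) k)) = Function.update (fun k => sgn (x k)) i (-sgn (x i)) := by
  funext k
  by_cases hk : k = i
  · subst hk
    simp [Site.shift, sgn_add_one]
  · simp [Site.shift, hk]

/-- `χ(x + eᵢ) = -χ(x)`. -/
theorem chi_shift (x : Site d 2) (i : Fin d) : chi (x.shift i) = -chi x := by
  unfold chi
  rw [show (∏ k, sgn ((x.shift i) k)) = ∏ k, (fun k => sgn ((x.shift i) k)) k from rfl,
    sgn_shift_apply, Finset.prod_update_of_mem (Finset.mem_univ i)]
  conv_rhs => rw [← Function.update_eq_self i (fun k => sgn (x k)),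
    Finset.prod_update_of_mem (Finset.mem_univ i)]
  ring

/-- `q(x + eᵢ, j) = -q(x, j)` if `i < j`. -/
theorem qsign_shift_of_lt (x : Site d 2) {i j : Fin d} (h : i < j) :
    qsign (x.shift i) j = -qsign x j := by
  unfold qsign
  have hi : i ∈ Finset.univ.filter (fun k => k < j) := by simp [h]
  rw [show (∏ k ∈ Finset.univ.filter (fun k => k < j), sgn ((x.shift i) k))
      = ∏ k ∈ Finset.univ.filter (fun k => k < j), (fun k => sgn ((x.shift i) k)) k from rfl,
    sgn_shift_apply, Finset.prod_update_of_mem hi]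
  conv_rhs => rw [← Function.update_eq_self i (fun k => sgn (x k)), Finset.prod_update_of_mem hi]
  ring

/-- `q(x + eᵢ, j) = q(x, j)` if `¬ i < j`. -/
theorem qsign_shift_of_not_lt (x : Site d 2) {i j : Fin d} (h : ¬ i < j) :
    qsign (x.shift i) j = qsign x j := by
  unfold qsign
  refine Finset.prod_congr rfl fun k hk => ?_
  have hki : k ≠ i := fun h' => h (h' ▸ (Finset.mem_filter.1 hk).2)
  rw [show sgn ((x.shift i) k) = Function.update (fun k => sgn (x k)) i (-sgn (x i)) k from
    congrFun (sgn_shift_apply x i) k, Function.update_of_ne hki]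

/-- `χ(x)² = 1`. -/
theorem chi_mul_self (x : Site d 2) : chi x * chi x = 1 := by
  unfold chi
  rw [← Finset.prod_mul_distrib]
  exact Finset.prod_eq_one fun k _ => sgn_mul_self _

/-- `q(x,j)² = 1`. -/
theorem qsign_mul_self (x : Site d 2) (j : Fin d) : qsign x j * qsign x j = 1 := by
  unfold qsign
  rw [← Finset.prod_mul_distrib]
  exact Finset.prod_eq_one fun k _ => sgn_mul_self _

/-! ## The witness: `SU(N)` links frustrated on an `su(2)` corner, staggered coexact directions -/

variable {m : ℕ}

/-- Diagonal entries `(r, r, 1, …, 1)` of the link matrices. -/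
def bvec (r : ℝ) : Fin (m + 2) → ℂ := fun a => if a = 0 ∨ a = 1 then (r : ℂ) else 1

/-- Diagonal entries `(i r, -i r, 0, …, 0)` of the direction matrices (an `su(2)` corner). -/
def vvec (r : ℝ) : Fin (m + 2) → ℂ := fun a =>
  if a = 0 then (r : ℂ) * I else if a = 1 then -((r : ℂ) * I) else 0

/-- `bvec r 0 = r`. -/
@[simp] theorem bvec_zero (r : ℝ) : bvec (m := m) r 0 = r := by simp [bvec]

/-- `bvec r 1 = r`. -/
@[simp] theorem bvec_one (r : ℝ) : bvec (m := m) r 1 = r := by simp [bvec]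

/-- `bvec r a = 1` beyond the corner. -/
@[simp] theorem bvec_succ_succ (r : ℝ) (a : Fin m) : bvec r a.succ.succ = 1 := by
  simp [bvec, Fin.succ_ne_zero, Fin.succ_succ_ne_one]

/-- `vvec r 0 = i r`. -/
@[simp] theorem vvec_zero (r : ℝ) : vvec (m := m) r 0 = (r : ℂ) * I := by simp [vvec]

/-- `vvec r 1 = -i r`. -/
@[simp] theorem vvec_one (r : ℝ) : vvec (m := m) r 1 = -((r : ℂ) * I) := by simp [vvec]

/-- `vvec r a = 0` beyond the corner. -/
@[simp] theorem vvec_succ_succ (r : ℝ) (a : Fin m) : vvec r a.succ.succ = 0 := by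
  simp [vvec, Fin.succ_ne_zero, Fin.succ_succ_ne_one]

/-- The entries of `bvec` are real. -/
theorem star_bvec (r : ℝ) : star (bvec (m := m) r) = bvec r := by
  funext a
  simp only [Pi.star_apply, bvec]
  split_ifs <;> simp [Complex.conj_ofReal]

/-- The entries of `vvec` are imaginary. -/
theorem star_vvec (r : ℝ) : star (vvec (m := m) r) = -vvec r := by
  funext a
  simp only [Pi.star_apply, Pi.neg_apply, vvec]
  split_ifs <;> simp [Complex.conj_ofReal, Complex.conj_I]

/-- The direction profile `c = e₀ - e₁` (non-zero, sum zero; needs `d ≥ 2`). -/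
def cdir {k : ℕ} (i : Fin (k + 2)) : ℝ := (if i = 0 then 1 else 0) - (if i = 1 then 1 else 0)

variable {k : ℕ}

/-- The frustrated configuration `Q(x,j) = diag(q(x,j), q(x,j), 1, …, 1)`. -/
def Qw (e : Edge (k + 2) 2) : Matrix (Fin (m + 2)) (Fin (m + 2)) ℂ := diagonal (bvec (qsign e.1 e.2))

/-- The staggered directions `X(x,i) = χ(x) c_i · diag(i, -i, 0, …, 0)`. -/
def Xw (e : Edge (k + 2) 2) : Matrix (Fin (m + 2)) (Fin (m + 2)) ℂ :=
  diagonal (vvec (chi e.1 * cdir e.2))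

/-- The links are unitary. -/
theorem Qw_mem_unitaryGroup (e : Edge (k + 2) 2) :
    Qw (m := m) e ∈ Matrix.unitaryGroup (Fin (m + 2)) ℂ := by
  rw [Matrix.mem_unitaryGroup_iff, Qw, Matrix.star_eq_conjTranspose, diagonal_conjTranspose,
    star_bvec, diagonal_mul_diagonal, ← diagonal_one]
  congr 1
  funext a
  simp only [bvec]
  split_ifs
  · rw [← Complex.ofReal_mul, qsign_mul_self, Complex.ofReal_one]
  · rw [mul_one]

/-- The links have determinant one (two equal signs on the corner), so lie in `SU(N)`. -/
theorem Qw_mem_specialUnitaryGroup (e : Edge (k + 2) 2) :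
    Qw (m := m) e ∈ Matrix.specialUnitaryGroup (Fin (m + 2)) ℂ := by
  rw [Matrix.mem_specialUnitaryGroup_iff]
  refine ⟨Qw_mem_unitaryGroup e, ?_⟩
  rw [Qw, det_diagonal, Fin.prod_univ_succ, Fin.prod_univ_succ]
  simp only [Fin.succ_zero_eq_one, bvec_zero, bvec_one, bvec_succ_succ, Finset.prod_const_one,
    mul_one]
  rw [← Complex.ofReal_mul, qsign_mul_self, Complex.ofReal_one]

/-- The directions are skew-Hermitian. -/
theorem Xw_skew (e : Edge (k + 2) 2) : (Xw (m := m) e)ᴴ = -Xw e := by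
  rw [Xw, diagonal_conjTranspose, star_vvec, diagonal_neg]
  rfl

/-- The directions are traceless. -/
theorem Xw_trace (e : Edge (k + 2) 2) : (Xw (m := m) e).trace = 0 := by
  rw [Xw, trace_diagonal, Fin.sum_univ_succ, Fin.sum_univ_succ]
  simp only [Fin.succ_zero_eq_one, vvec_zero, vvec_one, vvec_succ_succ, Finset.sum_const_zero,
    add_zero, add_neg_cancel]

/-! ## Evaluation of `word2` on diagonal data -/

/-- `word2` of diagonal matrices is the sum over the diagonal entries of the scalar words
`Re[(v₁+v₂+v₃+v₄)² b₁b₂b₃b₄]`. -/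
theorem word2_diagonal {n : Type*} [Fintype n] [DecidableEq n] (v₁ b₁ v₂ b₂ v₃ b₃ v₄ b₄ : n → ℂ) :
    word2 (diagonal v₁) (diagonal b₁) (diagonal v₂) (diagonal b₂) (diagonal v₃) (diagonal b₃)
        (diagonal v₄) (diagonal b₄) =
      ∑ a, ((v₁ a + v₂ a + v₃ a + v₄ a) ^ 2 * (b₁ a * b₂ a * b₃ a * b₄ a)).re := by
  unfold word2
  rw [← Complex.re_sum]
  congr 1
  simp only [diagonal_mul_diagonal, trace_diagonal, Finset.mul_sum, ← Finset.sum_add_distrib]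
  exact Finset.sum_congr rfl fun a _ => by ring

/-- `Re[(u i)² s] = -u² s` for real `u, s`. -/
theorem re_sq_mul (u s : ℝ) : ((((u : ℂ) * I) ^ 2) * (s : ℂ)).re = -(u ^ 2 * s) := by
  have h : ((u : ℂ) * I) ^ 2 * (s : ℂ) = ((-(u ^ 2 * s) : ℝ) : ℂ) := by
    rw [mul_pow, Complex.I_sq]; push_cast; ring
  rw [h, Complex.ofReal_re]

/-- The scalar word of the witness, entry by entry: `-(r₁+r₂-r₃-r₄)² s₁s₂s₃s₄` on the two corner
entries, `0` elsewhere. -/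
theorem entry_val (r₁ r₂ r₃ r₄ s₁ s₂ s₃ s₄ : ℝ) (a : Fin (m + 2)) :
    ((vvec r₁ a + vvec r₂ a + -vvec r₃ a + -vvec r₄ a) ^ 2
        * (bvec s₁ a * (bvec s₂ a * bvec s₃ a) * bvec s₄ a * 1)).re
      = if a = 0 ∨ a = 1 then -((r₁ + r₂ - r₃ - r₄) ^ 2 * (s₁ * s₂ * s₃ * s₄)) else 0 := by
  rcases Fin.eq_zero_or_eq_succ a with rfl | ⟨a', rfl⟩
  · simp only [vvec_zero, bvec_zero, true_or, if_true]
    rw [show ((r₁ : ℂ) * I + (r₂ : ℂ) * I + -((r₃ : ℂ) * I) + -((r₄ : ℂ) * I))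
        = ((r₁ + r₂ - r₃ - r₄ : ℝ) : ℂ) * I by push_cast; ring,
      show ((s₁ : ℂ) * ((s₂ : ℂ) * (s₃ : ℂ)) * (s₄ : ℂ) * 1) = ((s₁ * s₂ * s₃ * s₄ : ℝ) : ℂ) by
        push_cast; ring, re_sq_mul]
  · rcases Fin.eq_zero_or_eq_succ a' with rfl | ⟨a'', rfl⟩
    · simp only [Fin.succ_zero_eq_one, vvec_one, bvec_one, or_true, if_true]
      rw [show (-((r₁ : ℂ) * I) + -((r₂ : ℂ) * I) + - -((r₃ : ℂ) * I) + - -((r₄ : ℂ) * I))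
          = ((-(r₁ + r₂ - r₃ - r₄) : ℝ) : ℂ) * I by push_cast; ring,
        show ((s₁ : ℂ) * ((s₂ : ℂ) * (s₃ : ℂ)) * (s₄ : ℂ) * 1) = ((s₁ * s₂ * s₃ * s₄ : ℝ) : ℂ) by
          push_cast; ring, re_sq_mul]
      ring
    · simp [Fin.succ_ne_zero, Fin.succ_succ_ne_one]

/-- Summing a quantity supported on the two corner entries. -/
theorem sum_corner_ite (V : ℝ) : ∑ a : Fin (m + 2), (if a = 0 ∨ a = 1 then V else 0) = 2 * V := by
  rw [Fin.sum_univ_succ, Fin.sum_univ_succ, Finset.sum_eq_zero (fun a _ => by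
    simp [Fin.succ_ne_zero, Fin.succ_succ_ne_one])]
  simp only [Fin.succ_zero_eq_one, true_or, or_true, if_true, add_zero]
  ring

/-- **The plaquette value of the witness**: at every plaquette `(x; i<j)` of `(ℤ/2)^d`,
`plaqHess = 8(c_i - c_j)²` (two corner entries, each `((2χ(c_i-c_j))·i)² · (-1) = 4(c_i-c_j)²`). -/
theorem plaqHess_witness (x : Site (k + 2) 2) {i j : Fin (k + 2)} (hij : i < j) :
    plaqHess (Qw (m := m)) Xw x i j = 8 * (cdir i - cdir j) ^ 2 := by
  unfold plaqHess
  simp only [Qw, Xw]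
  rw [diagonal_conjTranspose, star_bvec, diagonal_conjTranspose, star_bvec, diagonal_mul_diagonal,
    diagonal_neg, diagonal_neg, ← diagonal_one, word2_diagonal]
  simp only [entry_val, sum_corner_ite]
  rw [chi_shift, chi_shift, qsign_shift_of_lt x hij, qsign_shift_of_not_lt x (not_lt.2 hij.le)]
  have hχ := chi_mul_self x
  have hi := qsign_mul_self x i
  have hj := qsign_mul_self x j
  linear_combination (8 * (cdir i - cdir j) ^ 2 * (qsign x i * qsign x i) * (qsign x j * qsign x j))
      * hχ + (8 * (cdir i - cdir j) ^ 2 * (qsign x j * qsign x j)) * hi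
      + (8 * (cdir i - cdir j) ^ 2) * hj

/-! ## Summation over the torus -/

/-- Scalar all-pairs identity: `Σ_a Σ_b (c_a - c_b)² = 2·#ι·Σ c² - 2 (Σ c)²`. -/
theorem sum_sum_sq_sub {ι : Type*} [Fintype ι] (c : ι → ℝ) :
    ∑ a, ∑ b, (c a - c b) ^ 2 = 2 * Fintype.card ι * ∑ a, c a ^ 2 - 2 * (∑ a, c a) ^ 2 := by
  have h1 : ∀ a, ∑ b, (c a - c b) ^ 2 =
      Fintype.card ι * c a ^ 2 + ∑ b, c b ^ 2 - 2 * (c a * ∑ b, c b) := by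
    intro a
    rw [Finset.mul_sum, Finset.mul_sum]
    simp_rw [sub_sq, Finset.sum_add_distrib, Finset.sum_sub_distrib, Finset.sum_const,
      Finset.card_univ, nsmul_eq_mul]
    ring
  simp_rw [h1, Finset.sum_sub_distrib, Finset.sum_add_distrib, ← Finset.mul_sum, ← Finset.sum_mul,
    Finset.sum_const, Finset.card_univ, nsmul_eq_mul]
  ring

/-- Ordered pairs `i<j` are half of all pairs for a symmetric summand vanishing on the diagonal. -/
theorem sum_sum_ite_lt_eq_half {d : ℕ} (g : Fin d → Fin d → ℝ) (hsymm : ∀ i j, g i j = g j i)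
    (hdiag : ∀ i, g i i = 0) :
    ∑ i, ∑ j, (if i < j then g i j else 0) = (∑ i, ∑ j, g i j) / 2 := by
  have hswap : ∑ i : Fin d, ∑ j : Fin d, (if j < i then g i j else 0)
      = ∑ i : Fin d, ∑ j : Fin d, (if i < j then g i j else 0) := by
    rw [Finset.sum_comm]
    refine Finset.sum_congr rfl fun i _ => Finset.sum_congr rfl fun j _ => ?_
    rw [hsymm j i]
  have hpt : ∀ i j : Fin d, g i j = (if i < j then g i j else 0) + (if j < i then g i j else 0) := by
    intro i j
    rcases lt_trichotomy i j with h | h | h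
    · simp [h, not_lt.2 h.le]
    · subst h; simp [hdiag]
    · simp [h, not_lt.2 h.le]
  have htot : ∑ i, ∑ j, g i j = ∑ i, ∑ j, (if i < j then g i j else 0)
      + ∑ i, ∑ j, (if j < i then g i j else 0) := by
    rw [← Finset.sum_add_distrib]
    refine Finset.sum_congr rfl fun i _ => ?_
    rw [← Finset.sum_add_distrib]
    exact Finset.sum_congr rfl fun j _ => hpt i j
  rw [htot, hswap]
  ring

/-- `Σ_i c_i = 0` for `c = e₀ - e₁`. -/
theorem sum_cdir : ∑ i : Fin (k + 2), cdir i = 0 := by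
  simp only [cdir, Finset.sum_sub_distrib, Finset.sum_ite_eq', Finset.mem_univ, if_true, sub_self]

/-- `Σ_i c_i² = 2` for `c = e₀ - e₁`. -/
theorem sum_cdir_sq : ∑ i : Fin (k + 2), cdir i ^ 2 = 2 := by
  have h : ∀ i : Fin (k + 2), cdir i ^ 2 = (if i = 0 then 1 else 0) + (if i = 1 then 1 else 0) := by
    intro i
    unfold cdir
    by_cases h0 : i = 0
    · subst h0; simp
    · by_cases h1 : i = 1
      · subst h1; simp
      · simp [h0, h1]
  simp only [h, Finset.sum_add_distrib, Finset.sum_ite_eq', Finset.mem_univ, if_true]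
  norm_num

/-- `Σ_{i<j} (c_i - c_j)² = 2d` for `c = e₀ - e₁` on `Fin d`, `d = k + 2`. -/
theorem sum_pairs_cdir :
    ∑ i : Fin (k + 2), ∑ j : Fin (k + 2), (if i < j then (cdir i - cdir j) ^ 2 else 0)
      = 2 * (k + 2 : ℕ) := by
  rw [sum_sum_ite_lt_eq_half (fun i j => (cdir i - cdir j) ^ 2) (fun i j => by ring)
    (fun i => by ring), sum_sum_sq_sub, sum_cdir, sum_cdir_sq, Fintype.card_fin]
  ring

/-- `‖diag(v)‖² = Σ_a |v_a|²`. -/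
theorem frobSq_diagonal {n : Type*} [Fintype n] [DecidableEq n] (v : n → ℂ) :
    frobSq (diagonal v) = ∑ a, Complex.normSq (v a) := by
  unfold frobSq
  rw [diagonal_conjTranspose, diagonal_mul_diagonal, trace_diagonal, Complex.re_sum]
  refine Finset.sum_congr rfl fun a _ => ?_
  rw [Pi.star_apply, Complex.star_def, Complex.mul_conj, Complex.ofReal_re]

/-- `‖X(x,i)‖² = 2 c_i²`. -/
theorem frobSq_witness (x : Site (k + 2) 2) (i : Fin (k + 2)) :
    frobSq (Xw (m := m) (x, i)) = 2 * cdir i ^ 2 := by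
  rw [Xw, frobSq_diagonal, Fin.sum_univ_succ, Fin.sum_univ_succ,
    Finset.sum_eq_zero (fun a _ => by simp)]
  simp only [Fin.succ_zero_eq_one, vvec_zero, vvec_one, Complex.normSq_neg, Complex.normSq_mul,
    Complex.normSq_ofReal, Complex.normSq_I, mul_one, add_zero]
  have hχ := chi_mul_self x
  linear_combination (2 * cdir i ^ 2) * hχ

/-- `Σ_e ‖X_e‖² = 4 · #sites`. -/
theorem tangentNormSq_witness :
    tangentNormSq (Xw (m := m) (k := k)) = 4 * Fintype.card (Site (k + 2) 2) := by
  unfold tangentNormSq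
  rw [Fintype.sum_prod_type]
  simp_rw [frobSq_witness, ← Finset.mul_sum, sum_cdir_sq, Finset.sum_const, Finset.card_univ,
    nsmul_eq_mul]
  ring

/-- `Σ_p plaqHess = 16 d · #sites`. -/
theorem hessianForm_witness :
    hessianForm (Qw (m := m) (k := k)) Xw = 16 * (k + 2 : ℕ) * Fintype.card (Site (k + 2) 2) := by
  rw [hessianForm_eq_sum_ite]
  have h : ∀ x : Site (k + 2) 2, ∑ i : Fin (k + 2), ∑ j : Fin (k + 2),
      (if i < j then plaqHess (Qw (m := m)) Xw x i j else 0) = 8 * (2 * (k + 2 : ℕ)) := by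
    intro x
    rw [← sum_pairs_cdir, Finset.mul_sum]
    refine Finset.sum_congr rfl fun i _ => ?_
    rw [Finset.mul_sum]
    refine Finset.sum_congr rfl fun j _ => ?_
    split_ifs with hij
    · exact plaqHess_witness x hij
    · simp
  simp_rw [h, Finset.sum_const, Finset.card_univ, nsmul_eq_mul]
  ring

/-- **Theorem C is sharp (Prop. D of HESSIAN-SHARP): the constant `4d` is attained.** On the torus
`(ℤ/2)^d`, `d = k + 2`, for `N = m + 2` colours, the `SU(N)`-valued frustrated configuration `Qw`
and the non-zero traceless skew-Hermitian staggered directions `Xw` satisfy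
`hessianForm Qw Xw = 4d · Σ_e ‖X_e‖²` with `Σ_e ‖X_e‖² > 0`. -/
theorem hessianForm_attained :
    hessianForm (Qw (m := m) (k := k)) Xw = 4 * (k + 2 : ℕ) * tangentNormSq (Xw (m := m) (k := k))
      ∧ 0 < tangentNormSq (Xw (m := m) (k := k)) := by
  rw [hessianForm_witness, tangentNormSq_witness]
  refine ⟨by ring, ?_⟩
  have : 0 < (Fintype.card (Site (k + 2) 2) : ℝ) := by exact_mod_cast Fintype.card_pos
  linarith

end Attained

end Summit.Ventures.YMGap.HessianSharp
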